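import Literature.AlgebraicGeometry.HodgeTheory.BettiKunnethPiecesHardLefschetzReduction
import Literature.AlgebraicGeometry.HodgeTheory.KunnethComponentsDiagonalAction
import Literature.AlgebraicGeometry.HodgeTheory.KunnethComponentsOfHodgeClasses
import HarnessLib

/-!
# `HC(X × X)` for every smooth projective `X` whose cohomology off the middle degree is algebraic and whose middle cohomology has `End_HS(Hⁿ(X)) = ℚ` — e.g. the general hypersurface of odd dimension:
# the middle Künneth component `πⁿ = [Δ_X]_{n,n}` spans `Hdgⁿ(Hⁿ(X) ⊗ Hⁿ(X))` (Voisin I §11.3.3 p. 287, Lemma 11.41; Voisin 2025 §3.2.1; Deligne 1982 Ex. 2.1 (b)) — unconditionally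

Family `hodge`, lane `lit-hodgefound` (Track 2 foundations library; Layers A2/A4), layer `Literature/AlgebraicGeometry/HodgeTheory`.  THEOREMS ONLY (no definition, no named fact, no instance;
D-0026 net debt `0`).  Sequel of the seat's g29-#2 (`BettiKunnethPiecesHardLefschetzReduction`: `HC(Y × Z)` from the pieces `Hⁱ(Y) ⊗ Hʲ(Z)`, `1 ≤ i ≤ dim Y`, `1 ≤ j ≤ dim Z`, granted `HC(Y)`, `HC(Z)`),
g29-#4 / g29-#5 (the `(2,2)`- and `(3,3)`-components of the diagonal of a surface / threefold), and the rational twin of the tree's `DiagonalKunnethComponentCasimir`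
(`ofRatClass_casimir_mem_algebraicClasses`: for `X` with algebraic off-middle cohomology the Poincaré Casimir of `Hⁿ(X;ℚ)` is algebraic on `X × X`), pushed to the Hodge conjecture for `X × X`.

THE MATHEMATICS.  Let `X` be smooth projective of dimension `n` with `Hᵏ(X;ℚ) = 0` for `k` odd, `k ≠ n`, and `H^{2p}(X;ℚ) = Hdgᵖ(H^{2p}(X))` for `2p ≠ n`, and assume `HC(X)` (so all of `H^{2p}(X;ℚ)`,
`2p ≠ n`, consists of algebraic classes; for `2p = n`, `HC` in the middle degree is part of the hypothesis `HC(X)`).  (Examples: smooth hypersurfaces and complete intersections of ODD dimension —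
`H^{2p} = ℚ·ηᵖ`; odd-dimensional quadric-like varieties; threefolds with `q = 0`, `h^{2,0} = 0` have this shape only after hard Lefschetz on `H⁴`, see g29-#5.)  The rational class `[Δ_X]` is a Hodge
class of `H^{2n}(X × X)`; its Künneth components `t_{i,2n−i}` are Hodge classes of the pieces, and for `i ≠ n` their cross products are ALGEBRAIC: `Hⁱ = 0` for `i` odd, and for `i = 2a` even the
piece `H^{2a} ⊗ H^{2n−2a}` has Hodge classes `H^{2a} ⊗ Hdg(H^{2n−2a})` (the first factor is pure of type `(a,a)`, Deligne 2.1.13), exterior products of algebraic classes.  Hence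
`crossMap t_{n,n} ⊗ 1 = [Δ] − Σ_{i ≠ n} crossMap t_{i,2n−i} ⊗ 1` is ALGEBRAIC and acts as the IDENTITY on `Hⁿ(X;ℂ)` (`[Δ]_* = Id`; the other pieces act by zero on `Hⁿ`).  If `End_HS(Hⁿ(X)) = ℚ`
then `Hdgⁿ(Hⁿ ⊗ Hⁿ) ≅ End_HS(Hⁿ)` (Lemma 11.41) is `ℚ·t_{n,n}`.  Every other piece `Hⁱ ⊗ Hʲ` (`1 ≤ i, j ≤ n`, `(i,j) ≠ (n,n)`) is zero or has a pure factor; so by g29-#2, **`HC(X × X)`**.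

THE PRINTS.  C. Voisin (2002) [VoisinHodgeI2002] §11.3.3 Thm. 11.38, Thm. 11.40, Lemma 11.41 (p. 286), p. 287; §11.3.2.  C. Voisin (2025) [Voisin2025] §3.2.1 (12)–(14), Prop. 3.8.  P. Deligne (1982)
[Deligne1982HodgeCycles] §2 Ex. 2.1 (b) (`cl(Δ) = Σ πⁱ`).  C. Voisin (2003) [VoisinHodgeII2003] §9.2.4 proof of Prop. 9.20 (exterior products); proof of Thm. 10.17 (10.7).  P. Deligne (1971) [DeligneHodgeII1971]
2.1.13.  W. Fulton (1997) [FultonYoungTableaux1997] App. B §B.1 (5)–(6).  P. Deligne (2000) [Deligne2000] §1.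

THE OBJECTS (all the tree's).  `X Y Z : SchemeOver ℂ`; `Hᵏ(X) = BettiUniverse.hodge hHD hX k`; `BettiUniverse.kunnethSummand`, `BettiUniverse.crossMap`; `ofRatClass`, `algebraicClasses`, `HodgeConjectureFor`;
`diagonalClass hX = cl(Δ)`, `kunnethPiece`, `corrAction complexOrientationFamily hX hX hab γ`.

WHAT IS PROVED (no hypothesis beyond smooth projectivity and the lane's binder `hHD`).
* §1 **Pieces with a pure even factor**: if `Hdgᵃ(H^{2a}(Y)) = H^{2a}(Y;ℚ)` consists of classes with algebraic complexification and the Hodge classes of `H^{2b}(Z)` have algebraic complexification, every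
  Hodge class of `H^{2a}(Y) ⊗ H^{2b}(Z)` has algebraic cross product (`BettiUniverse.ofRatClass_crossMap_mem_algebraicClasses_of_hodgeClasses_eq_top_left`, mirror `…_right`).
* §2 **THE MIDDLE KÜNNETH COMPONENT `t_{n,n}` OF `[Δ_X]`** for `X` with algebraic off-middle cohomology: a Hodge class of `Hⁿ(X) ⊗ Hⁿ(X)` with ALGEBRAIC cross product acting as the IDENTITY on
  `Hⁿ(X;ℂ)` (`BettiUniverse.exists_kunneth_middle_algebraic_corrAction_eq_id`).
* §3 **`HC(X × X)` for every such `X` with `dim_ℚ End_HS(Hⁿ(X)) ≤ 1`** (`BettiUniverse.hodgeConjectureFor_tensor_self_of_offMiddle_algebraic_of_finrank_end_le_one`).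

DEVIATIONS / SCOPE.  For even `n` the hypothesis `dim End_HS(Hⁿ) ≤ 1` forces `bₙ ≤ 1` as soon as `Hⁿ` carries a Hodge class (`η^{n/2}`); the theorem is aimed at odd `n`.  Varieties whose middle
cohomology has extra endomorphisms (CM, automorphisms) are not covered.

## References
* [VoisinHodgeI2002] C. Voisin, *Hodge Theory and Complex Algebraic Geometry I* (2002) — §11.3.3 Thm. 11.38, Thm. 11.40, Lemma 11.41, p. 287; §11.3.2.
* [Voisin2025] C. Voisin, *Hodge and generalized Hodge conjectures, coniveau and algebraic cycles*, J. Open Math. Probl. 1 (2025) — §3.2.1 (12)–(14), Prop. 3.8.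
* [Deligne1982HodgeCycles] P. Deligne, *Hodge cycles on abelian varieties*, LNM 900 (1982) — §2 Ex. 2.1 (b).
* [VoisinHodgeII2003] C. Voisin, *Hodge Theory and Complex Algebraic Geometry II* (2003) — §9.2.4 proof of Prop. 9.20; proof of Thm. 10.17, (10.7).
* [DeligneHodgeII1971] P. Deligne, *Théorie de Hodge II* (1971) — 2.1.13.
* [FultonYoungTableaux1997] W. Fulton, *Young Tableaux* (1997) — App. B §B.1 (5)–(6).
* [Deligne2000] P. Deligne, *The Hodge conjecture* (Clay, 2000) — §1.

## Provenance
Lane `lit-hodgefound` (Hodge path, Track 2), prover seat `lit-hodgefound-p29` (generation 29), self-proposed row g29-#6 (the general middle-degree form of g29-#4/#5).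
-/

noncomputable section

open scoped TensorProduct
open CategoryTheory MonoidalCategory CartesianMonoidalCategory Module Finset
open Literature.AlgebraicTopology.SingularHomology
open Literature.Geometry.Kaehler

namespace Literature.AlgebraicGeometry.HodgeTheory

open Literature.AlgebraicGeometry.Motives
open Literature.AlgebraicGeometry.Motives.HodgeStructure

variable {m n d : ℕ} {X Y Z : SchemeOver ℂ}

/-! ### §0 Plumbing -/

/-- `(q • a) ⊗ 1 = q • (a ⊗ 1)` for the lattice map `Hᵏ(Y;ℚ) → Hᵏ(Y;ℂ)` (private copy of the tree's file-local lemma). [cite: HatcherAT2002, §3.1 p. 198] -/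
private theorem ofRatClass_rat_smul' {T : Type} [TopologicalSpace T] {k : ℕ} (q : ℚ) (a : singularCohomology ℚ ℚ T k) :
    ofRatClass T k (q • a) = (q : ℂ) • ofRatClass T k a := by
  rw [ofRatClass, coeffClass_smul, smul_coeffClass]
  refine coeffClass_congr (fun x ↦ ?_) a
  simp

/-! ### §1 Pieces with a pure even factor -/

section PureFactor

variable [HodgeTensorFacts.{0, 0}]

/-- **A piece `H^{2a}(Y) ⊗ H^{2b}(Z)` whose first factor is pure of type `(a,a)` with algebraic classes**: if `Hdgᵃ(H^{2a}(Y)) = H^{2a}(Y;ℚ)`, every class of `H^{2a}(Y;ℚ)` has algebraic complexification, and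
the Hodge classes of `H^{2b}(Z)` have algebraic complexification, then every Hodge class of the piece has algebraic cross product — the Hodge classes are `H^{2a}(Y) ⊗ Hdgᵇ(H^{2b}(Z))` (Deligne 2.1.13),
exterior products of algebraic classes. [cite: DeligneHodgeII1971, 2.1.13] [cite: VoisinHodgeI2002, §11.3.3 Lemma 11.41 and p. 287] [cite: VoisinHodgeII2003, §9.2.4 proof of Prop. 9.20] -/
theorem BettiUniverse.ofRatClass_crossMap_mem_algebraicClasses_of_hodgeClasses_eq_top_left (hHD : exists_isReal_hodgeModel) (hY : IsSmoothProjective m Y) (hZ : IsSmoothProjective n Z)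
    {a b c : ℕ} (hc : 2 * a + 2 * b = 2 * c) (htop : (BettiUniverse.hodge hHD hY (2 * a)).hodgeClasses a = ⊤)
    (hYalg : ∀ u : bettiCohomology Y (2 * a), ofRatClass (ComplexPoints Y) (2 * a) u ∈ algebraicClasses Y a)
    (hZalg : ∀ w ∈ (BettiUniverse.hodge hHD hZ (2 * b)).hodgeClasses b, ofRatClass (ComplexPoints Z) (2 * b) w ∈ algebraicClasses Z b)
    {t : bettiCohomology Y (2 * a) ⊗[ℚ] bettiCohomology Z (2 * b)} (ht : t ∈ (BettiUniverse.kunnethSummand hHD hY hZ (2 * c) ⟨(2 * a, 2 * b), HasAntidiagonal.mem_antidiagonal.2 hc⟩).hodgeClasses c) :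
    ofRatClass (ComplexPoints (Y ⊗ Z)) (2 * c) (BettiUniverse.crossMap Y Z hc t) ∈ algebraicClasses (Y ⊗ Z) c := by
  obtain rfl : c = a + b := by omega
  haveI := BettiUniverse.finite hY (2 * a)
  haveI := BettiUniverse.finite hZ (2 * b)
  have hspan := HodgeStructure.hodgeClasses_tensor_eq_span_of_hodgeClasses_eq_top (BettiUniverse.hodge hHD hY (2 * a)) htop (by push_cast; ring) (BettiUniverse.hodge hHD hZ (2 * b)) (b : ℤ)
  have hle : Submodule.span ℚ (Set.image2 (fun u w ↦ u ⊗ₜ[ℚ] w) Set.univ (((BettiUniverse.hodge hHD hZ (2 * b)).hodgeClasses b : Set (bettiCohomology Z (2 * b))))) ≤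
      LinearMap.range (TensorProduct.mapIncl (⊤ : Submodule ℚ (bettiCohomology Y (2 * a))) ((BettiUniverse.hodge hHD hZ (2 * b)).hodgeClasses b)) :=
    Submodule.span_le.2 (by
      rintro _ ⟨u, -, w, hw, rfl⟩
      exact ⟨(⟨u, Submodule.mem_top⟩ : ↥(⊤ : Submodule ℚ (bettiCohomology Y (2 * a)))) ⊗ₜ[ℚ] (⟨w, hw⟩ : ↥((BettiUniverse.hodge hHD hZ (2 * b)).hodgeClasses b)),
        by rw [TensorProduct.mapIncl, TensorProduct.map_tmul]; rfl⟩)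
  have ht' : t ∈ LinearMap.range (TensorProduct.mapIncl (⊤ : Submodule ℚ (bettiCohomology Y (2 * a))) ((BettiUniverse.hodge hHD hZ (2 * b)).hodgeClasses b)) := by
    refine hle ?_
    rw [← hspan]
    change t ∈ (((BettiUniverse.hodge hHD hY (2 * a)).tensor (BettiUniverse.hodge hHD hZ (2 * b))).cast _).hodgeClasses _ at ht
    rw [HodgeStructure.cast_hodgeClasses, show (((a + b : ℕ)) : ℤ) = (a : ℤ) + (b : ℤ) by push_cast; ring] at ht
    exact ht
  obtain ⟨w, rfl⟩ := ht'
  clear ht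
  induction w using TensorProduct.induction_on with
  | zero => rw [map_zero, map_zero, map_zero]; exact Submodule.zero_mem _
  | tmul p q =>
    rw [TensorProduct.mapIncl, TensorProduct.map_tmul, Submodule.subtype_apply, Submodule.subtype_apply, BettiUniverse.crossMap_tmul, BettiUniverse.ofRatClass_bettiCup, BettiUniverse.ofRatClass_pull,
      BettiUniverse.ofRatClass_pull]
    exact cupProduct_map_fst_map_snd_mem_supportedClasses hY hZ hc (hYalg p) (hZalg q q.2)
  | add x y hx hy => rw [map_add, map_add, map_add]; exact Submodule.add_mem _ hx hy

/-- **The mirror: a piece `H^{2a}(Y) ⊗ H^{2b}(Z)` whose SECOND factor is pure of type `(b,b)` with algebraic classes.** [cite: DeligneHodgeII1971, 2.1.13] [cite: VoisinHodgeI2002, §11.3.3 Lemma 11.41 and p. 287]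
[cite: VoisinHodgeII2003, §9.2.4 proof of Prop. 9.20] -/
theorem BettiUniverse.ofRatClass_crossMap_mem_algebraicClasses_of_hodgeClasses_eq_top_right (hHD : exists_isReal_hodgeModel) (hY : IsSmoothProjective m Y) (hZ : IsSmoothProjective n Z)
    {a b c : ℕ} (hc : 2 * a + 2 * b = 2 * c) (htop : (BettiUniverse.hodge hHD hZ (2 * b)).hodgeClasses b = ⊤)
    (hYalg : ∀ u ∈ (BettiUniverse.hodge hHD hY (2 * a)).hodgeClasses a, ofRatClass (ComplexPoints Y) (2 * a) u ∈ algebraicClasses Y a)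
    (hZalg : ∀ w : bettiCohomology Z (2 * b), ofRatClass (ComplexPoints Z) (2 * b) w ∈ algebraicClasses Z b)
    {t : bettiCohomology Y (2 * a) ⊗[ℚ] bettiCohomology Z (2 * b)} (ht : t ∈ (BettiUniverse.kunnethSummand hHD hY hZ (2 * c) ⟨(2 * a, 2 * b), HasAntidiagonal.mem_antidiagonal.2 hc⟩).hodgeClasses c) :
    ofRatClass (ComplexPoints (Y ⊗ Z)) (2 * c) (BettiUniverse.crossMap Y Z hc t) ∈ algebraicClasses (Y ⊗ Z) c := by
  obtain rfl : c = a + b := by omega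
  haveI := BettiUniverse.finite hY (2 * a)
  haveI := BettiUniverse.finite hZ (2 * b)
  have hspan := HodgeStructure.hodgeClasses_tensor_eq_span_of_hodgeClasses_eq_top_right (BettiUniverse.hodge hHD hY (2 * a)) (a : ℤ) (BettiUniverse.hodge hHD hZ (2 * b)) htop (by push_cast; ring)
  have hle : Submodule.span ℚ (Set.image2 (fun w u ↦ w ⊗ₜ[ℚ] u) (((BettiUniverse.hodge hHD hY (2 * a)).hodgeClasses a : Set (bettiCohomology Y (2 * a)))) Set.univ) ≤
      LinearMap.range (TensorProduct.mapIncl ((BettiUniverse.hodge hHD hY (2 * a)).hodgeClasses a) (⊤ : Submodule ℚ (bettiCohomology Z (2 * b)))) :=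
    Submodule.span_le.2 (by
      rintro _ ⟨w, hw, u, -, rfl⟩
      exact ⟨(⟨w, hw⟩ : ↥((BettiUniverse.hodge hHD hY (2 * a)).hodgeClasses a)) ⊗ₜ[ℚ] (⟨u, Submodule.mem_top⟩ : ↥(⊤ : Submodule ℚ (bettiCohomology Z (2 * b)))),
        by rw [TensorProduct.mapIncl, TensorProduct.map_tmul]; rfl⟩)
  have ht' : t ∈ LinearMap.range (TensorProduct.mapIncl ((BettiUniverse.hodge hHD hY (2 * a)).hodgeClasses a) (⊤ : Submodule ℚ (bettiCohomology Z (2 * b)))) := by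
    refine hle ?_
    rw [← hspan]
    change t ∈ (((BettiUniverse.hodge hHD hY (2 * a)).tensor (BettiUniverse.hodge hHD hZ (2 * b))).cast _).hodgeClasses _ at ht
    rw [HodgeStructure.cast_hodgeClasses, show (((a + b : ℕ)) : ℤ) = (a : ℤ) + (b : ℤ) by push_cast; ring] at ht
    exact ht
  obtain ⟨w, rfl⟩ := ht'
  clear ht
  induction w using TensorProduct.induction_on with
  | zero => rw [map_zero, map_zero, map_zero]; exact Submodule.zero_mem _
  | tmul p q =>
    rw [TensorProduct.mapIncl, TensorProduct.map_tmul, Submodule.subtype_apply, Submodule.subtype_apply, BettiUniverse.crossMap_tmul, BettiUniverse.ofRatClass_bettiCup, BettiUniverse.ofRatClass_pull,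
      BettiUniverse.ofRatClass_pull]
    exact cupProduct_map_fst_map_snd_mem_supportedClasses hY hZ hc (hYalg p p.2) (hZalg q)
  | add x y hx hy => rw [map_add, map_add, map_add]; exact Submodule.add_mem _ hx hy

omit [HodgeTensorFacts.{0, 0}] in
/-- A Künneth piece `Hⁱ(Y) ⊗ Hʲ(Z)` with a factor of dimension zero carries only the zero class (so its cross products are trivially algebraic). [cite: HatcherAT2002, §3.2 Thm. 3.15–3.16] [cite: VoisinHodgeI2002, §11.3.3 Thm. 11.38] -/
theorem BettiUniverse.ofRatClass_crossMap_mem_algebraicClasses_of_finrank_eq_zero (hY : IsSmoothProjective m Y) (hZ : IsSmoothProjective n Z) {i j c : ℕ} (hc : i + j = 2 * c)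
    (h : Module.finrank ℚ (bettiCohomology Y i) = 0 ∨ Module.finrank ℚ (bettiCohomology Z j) = 0) (t : bettiCohomology Y i ⊗[ℚ] bettiCohomology Z j) :
    ofRatClass (ComplexPoints (Y ⊗ Z)) (2 * c) (BettiUniverse.crossMap Y Z hc t) ∈ algebraicClasses (Y ⊗ Z) c := by
  haveI := BettiUniverse.finite hY i
  haveI := BettiUniverse.finite hZ j
  haveI : Subsingleton (bettiCohomology Y i ⊗[ℚ] bettiCohomology Z j) := by
    rcases h with h | h
    · haveI : Subsingleton (bettiCohomology Y i) := Module.finrank_zero_iff.1 h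
      infer_instance
    · haveI : Subsingleton (bettiCohomology Z j) := Module.finrank_zero_iff.1 h
      infer_instance
  rw [Subsingleton.elim t 0, map_zero, map_zero]
  exact Submodule.zero_mem _

end PureFactor

/-! ### §2 The middle Künneth component of the diagonal when the off-middle cohomology is algebraic -/

section MiddleDiagonal

variable [HodgeTensorFacts.{0, 0}]

/-- **The middle Künneth component `t_{n,n}` of `[Δ_X]`.**  Let `X` be smooth projective of dimension `n` with `HC(X)`, `Hᵏ(X;ℚ) = 0` for odd `k ≠ n` and `Hdgᵖ(H^{2p}(X)) = H^{2p}(X;ℚ)` for `2p ≠ n`.  Then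
there is a Hodge class `t ∈ Hdgⁿ(Hⁿ(X) ⊗ Hⁿ(X))` with `crossMap t ⊗ 1` ALGEBRAIC on `X × X` and acting as the IDENTITY on `Hⁿ(X;ℂ)`: `[Δ] ⊗ ℚ` is a Hodge class, its other Künneth components `t_{i,2n−i}`,
`i ≠ n`, are zero (`i` odd) or have a pure factor (`i` even), hence algebraic cross products (§1), `[Δ]_* = Id`, and a piece `Hⁱ ⊗ Hʲ` with `j ≠ n` acts by zero on `Hⁿ`. [cite: VoisinHodgeI2002, §11.3.3 Thm. 11.38–11.40 and p. 287]
[cite: Voisin2025, §3.2.1 (12)–(14)] [cite: Deligne1982HodgeCycles, §2 Example 2.1 (b)] -/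
theorem BettiUniverse.exists_kunneth_middle_algebraic_corrAction_eq_id (hHD : exists_isReal_hodgeModel) (hX : IsSmoothProjective n X) (hHC : HodgeConjectureFor n X)
    (hodd : ∀ k, Odd k → k ≠ n → Module.finrank ℚ (bettiCohomology X k) = 0) (heven : ∀ p, 2 * p ≠ n → (BettiUniverse.hodge hHD hX (2 * p)).hodgeClasses p = ⊤) :
    ∃ t ∈ (BettiUniverse.kunnethSummand hHD hX hX (2 * n) ⟨(n, n), HasAntidiagonal.mem_antidiagonal.2 (two_mul n).symm⟩).hodgeClasses n,
      ofRatClass (ComplexPoints (X ⊗ X)) (2 * n) (BettiUniverse.crossMap X X (two_mul n).symm t) ∈ algebraicClasses (X ⊗ X) n ∧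
      corrAction complexOrientationFamily hX hX (rfl : n + 2 * n = n + 2 * n) (ofRatClass (ComplexPoints (X ⊗ X)) (2 * n) (BettiUniverse.crossMap X X (two_mul n).symm t)) = LinearMap.id := by
  have hXX : IsSmoothProjective (n + n) (X ⊗ X) := hX.tensor_holds hX
  have halgX : ∀ (p : ℕ), ∀ z ∈ (BettiUniverse.hodge hHD hX (2 * p)).hodgeClasses (p : ℤ), ofRatClass (ComplexPoints X) (2 * p) z ∈ algebraicClasses X p :=
    fun p z hz ↦ hHC.2 p _ (isRationalClass_ofRatClass _) ((BettiUniverse.mem_hodgeClasses_hodge_iff_isOfHodgeType hHD hX p z).1 hz)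
  -- the other Künneth pieces of `H^{2n}(X × X)` have algebraic Hodge classes
  have hpiece : ∀ (i j : ℕ) (hij : i + j = 2 * n), j ≠ n →
      ∀ u ∈ (BettiUniverse.kunnethSummand hHD hX hX (2 * n) ⟨(i, j), HasAntidiagonal.mem_antidiagonal.2 hij⟩).hodgeClasses n,
        ofRatClass (ComplexPoints (X ⊗ X)) (2 * n) (BettiUniverse.crossMap X X hij u) ∈ algebraicClasses (X ⊗ X) n := by
    intro i j hij hjn u hu
    rcases Nat.even_or_odd i with ⟨a, ha⟩ | hi
    · obtain ⟨a, rfl⟩ : ∃ a', i = 2 * a' := ⟨a, by omega⟩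
      obtain ⟨b, rfl⟩ : ∃ b, j = 2 * b := ⟨j / 2, by omega⟩
      have han : 2 * a ≠ n := by omega
      exact BettiUniverse.ofRatClass_crossMap_mem_algebraicClasses_of_hodgeClasses_eq_top_left hHD hX hX hij (heven a han)
        (fun z ↦ halgX a z (by rw [heven a han]; exact Submodule.mem_top)) (halgX b) hu
    · have hin : i ≠ n := by omega
      exact BettiUniverse.ofRatClass_crossMap_mem_algebraicClasses_of_finrank_eq_zero hX hX hij (Or.inl (hodd i hi hin)) u
  -- the rational diagonal class and its Künneth decomposition into Hodge classes
  obtain ⟨δ, hδ⟩ := (isRationalClass_iff_mem_range_ofRatClass _).1 (isRationalClass_diagonalClass hX)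
  have hδH : δ ∈ (BettiUniverse.hodge hHD hXX (2 * n)).hodgeClasses n := by
    refine (BettiUniverse.mem_hodgeClasses_hodge_iff_isOfHodgeType hHD hXX n δ).2 ?_
    rw [hδ]
    exact isOfHodgeType_of_mem_algebraicClasses_of_isSmoothProjective hXX n (diagonalClass_mem_algebraicClasses hX)
  obtain ⟨t, ⟨ht, hsum⟩, -⟩ := BettiUniverse.exists_eq_kunnethMap_of_mem_hodgeClasses hHD hodgePQ_independent_of_hodgeModel_holds hX hX hXX (2 * n) n hδH
  set inn : ↥(antidiagonal (2 * n)) := ⟨(n, n), HasAntidiagonal.mem_antidiagonal.2 (two_mul n).symm⟩ with hinn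
  have hsplit : ofRatClass (ComplexPoints (X ⊗ X)) (2 * n) δ =
      ofRatClass (ComplexPoints (X ⊗ X)) (2 * n) (BettiUniverse.crossMap X X (mem_antidiagonal.1 inn.2) (t inn)) +
        ∑ ij ∈ univ.erase inn, ofRatClass (ComplexPoints (X ⊗ X)) (2 * n) (BettiUniverse.crossMap X X (mem_antidiagonal.1 ij.2) (t ij)) := by
    rw [hsum, map_sum, ← Finset.add_sum_erase univ _ (Finset.mem_univ inn)]
  have hothers : ∀ ij ∈ univ.erase inn, ij.1.2 ≠ n := by
    intro ij hij h
    have hne : ij ≠ inn := (Finset.mem_erase.1 hij).1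
    have hsum' : ij.1.1 + ij.1.2 = 2 * n := mem_antidiagonal.1 ij.2
    exact hne (Subtype.ext (Prod.ext (show ij.1.1 = n by omega) h))
  refine ⟨t inn, ht inn, ?_, ?_⟩
  · -- algebraicity
    have e : ofRatClass (ComplexPoints (X ⊗ X)) (2 * n) (BettiUniverse.crossMap X X (two_mul n).symm (t inn)) =
        diagonalClass hX - ∑ ij ∈ univ.erase inn, ofRatClass (ComplexPoints (X ⊗ X)) (2 * n) (BettiUniverse.crossMap X X (mem_antidiagonal.1 ij.2) (t ij)) := by
      rw [← hδ, hsplit, add_sub_cancel_right]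
    rw [e]
    refine Submodule.sub_mem _ (diagonalClass_mem_algebraicClasses hX) (Submodule.sum_mem _ fun ij hij ↦ ?_)
    obtain ⟨⟨i, j⟩, hij'⟩ := ij
    have h := hpiece i j (mem_antidiagonal.1 hij') (hothers _ hij) (t ⟨(i, j), hij'⟩) (ht ⟨(i, j), hij'⟩)
    exact h
  · -- identity action on `Hⁿ`
    have hid := corrAction_diagonalClass_eq_id hX (rfl : n + 2 * n = n + 2 * n)
    rw [← hδ, hsplit, map_add, map_sum, Finset.sum_eq_zero fun ij hij ↦ ?_, add_zero] at hid
    · exact hid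
    obtain ⟨⟨i, j⟩, hij'⟩ := ij
    have hj : j ≠ n := hothers _ hij
    have hij2 : i + j = 2 * n := mem_antidiagonal.1 hij'
    have hz := corrAction_eq_zero_of_mem_kunnethPiece_of_ne complexOrientationFamily hX hX (e := n) (i := j) (j := i) hij2
      (ofRatClass_crossMap_mem_kunnethPiece hij2 (t ⟨(i, j), hij'⟩)) (a := n) (b := n) rfl (show n + j ≠ 2 * n by omega)
    exact hz

end MiddleDiagonal

/-! ### §3 `HC(X × X)` -/

/-- **`HC(X × X)` for every smooth projective `X` of dimension `n` with `HC(X)`, `Hᵏ(X;ℚ) = 0` for odd `k ≠ n`, `Hdgᵖ(H^{2p}(X)) = H^{2p}(X;ℚ)` for `2p ≠ n`, and `dim_ℚ End_HS(Hⁿ(X)) ≤ 1`** —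
UNCONDITIONALLY: by g29-#2 only the pieces `Hⁱ ⊗ Hʲ`, `1 ≤ i, j ≤ n`, matter; those with `(i,j) ≠ (n,n)` are zero or have a pure factor (§1); and `Hdgⁿ(Hⁿ ⊗ Hⁿ)` (of dimension `dim End_HS(Hⁿ) ≤ 1`,
Lemma 11.41) is spanned by the class `t_{n,n}` of §2 (non-zero as soon as `Hⁿ ≠ 0`).  E.g. the general smooth hypersurface or complete intersection of ODD dimension `n` (`H^{2p} = ℚ ηᵖ`,
`H^{odd ≠ n} = 0`, big monodromy ⇒ `End_HS(Hⁿ) = ℚ`). [cite: VoisinHodgeI2002, §11.3.3 Lemma 11.41 and p. 287, §11.3.2] [cite: Voisin2025, §3.2.1 (12)–(14)] [cite: Deligne1982HodgeCycles, §2 Example 2.1 (b)] [cite: Deligne2000, §1] -/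
theorem BettiUniverse.hodgeConjectureFor_tensor_self_of_offMiddle_algebraic_of_finrank_end_le_one (hHD : exists_isReal_hodgeModel) (hX : IsSmoothProjective n X)
    (hXX : IsSmoothProjective d (X ⊗ X)) (hHC : HodgeConjectureFor n X) (hodd : ∀ k, Odd k → k ≠ n → Module.finrank ℚ (bettiCohomology X k) = 0)
    (heven : ∀ p, 2 * p ≠ n → (BettiUniverse.hodge hHD hX (2 * p)).hodgeClasses p = ⊤)
    (hEnd : Module.finrank ℚ (HodgeStructure.Hom (BettiUniverse.hodge hHD hX n) (BettiUniverse.hodge hHD hX n)) ≤ 1) : HodgeConjectureFor d (X ⊗ X) := by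
  haveI : HodgeTensorFacts.{0, 0} := hodgeTensorFacts_holds
  haveI := BettiUniverse.finite hX n
  have halgX : ∀ (p : ℕ), ∀ z ∈ (BettiUniverse.hodge hHD hX (2 * p)).hodgeClasses (p : ℤ), ofRatClass (ComplexPoints X) (2 * p) z ∈ algebraicClasses X p :=
    fun p z hz ↦ hHC.2 p _ (isRationalClass_ofRatClass _) ((BettiUniverse.mem_hodgeClasses_hodge_iff_isOfHodgeType hHD hX p z).1 hz)
  obtain ⟨t₀, ht₀, halg₀, hid₀⟩ := BettiUniverse.exists_kunneth_middle_algebraic_corrAction_eq_id hHD hX hHC hodd heven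
  refine BettiUniverse.hodgeConjectureFor_tensor_of_kunneth_pieces_pos_le hHD hX hX hXX hHC hHC fun c i j hij hi1 hi hj1 hj hc2 t ht ↦ ?_
  by_cases hmid : i = n ∧ j = n
  · -- the middle piece `Hⁿ ⊗ Hⁿ`
    obtain ⟨hin, hjn⟩ := hmid
    have hin' : n = i := hin.symm
    have hjn' : n = j := hjn.symm
    subst hin'
    subst hjn'
    obtain rfl : n = c := by omega
    by_cases h0 : Module.finrank ℚ (bettiCohomology X n) = 0
    · exact BettiUniverse.ofRatClass_crossMap_mem_algebraicClasses_of_finrank_eq_zero hX hX hij (Or.inl h0) t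
    have ht₀ne : t₀ ≠ 0 := by
      intro ht0
      apply h0
      haveI : Subsingleton (bettiCohomology X n) := by
        refine ⟨fun u v ↦ ofRatClass_injective n ?_⟩
        have key : ∀ x : complexBetti X n, x = 0 := fun x ↦ by
          have hx := LinearMap.congr_fun hid₀ x
          rw [ht0, map_zero, map_zero, map_zero, LinearMap.zero_apply, LinearMap.id_apply] at hx
          exact hx.symm
        rw [key (ofRatClass _ n u), key (ofRatClass _ n v)]
      exact Module.finrank_zero_of_subsingleton
    have ht₀' : t₀ ∈ ((BettiUniverse.hodge hHD hX n).tensor (BettiUniverse.hodge hHD hX n)).hodgeClasses (n : ℤ) := ht₀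
    have hle : (ℚ ∙ t₀) ≤ ((BettiUniverse.hodge hHD hX n).tensor (BettiUniverse.hodge hHD hX n)).hodgeClasses (n : ℤ) := (Submodule.span_singleton_le_iff_mem _ _).2 ht₀'
    have hHrank : Module.finrank ℚ ↥(((BettiUniverse.hodge hHD hX n).tensor (BettiUniverse.hodge hHD hX n)).hodgeClasses (n : ℤ)) =
        Module.finrank ℚ (HodgeStructure.Hom (BettiUniverse.hodge hHD hX n) (BettiUniverse.hodge hHD hX n)) :=
      BettiUniverse.finrank_hodgeClasses_tensor_hodge_eq_finrank_hom hHD hX hX n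
    have hPeq : (ℚ ∙ t₀) = ((BettiUniverse.hodge hHD hX n).tensor (BettiUniverse.hodge hHD hX n)).hodgeClasses (n : ℤ) :=
      Submodule.eq_of_le_of_finrank_le hle (by rw [hHrank, finrank_span_singleton ht₀ne]; exact hEnd)
    have ht' : t ∈ ℚ ∙ t₀ := by
      rw [hPeq]
      exact ht
    obtain ⟨q, rfl⟩ := Submodule.mem_span_singleton.1 ht'
    rw [map_smul, ofRatClass_rat_smul']
    exact Submodule.smul_mem _ _ halg₀
  -- the other pieces: zero or with a pure factor
  rcases Nat.even_or_odd i with ⟨a, ha⟩ | hio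
  · obtain ⟨a, rfl⟩ : ∃ a', i = 2 * a' := ⟨a, by omega⟩
    obtain ⟨b, rfl⟩ : ∃ b, j = 2 * b := ⟨j / 2, by omega⟩
    by_cases han : 2 * a = n
    · have hbn : 2 * b ≠ n := fun h ↦ hmid ⟨han, h⟩
      exact BettiUniverse.ofRatClass_crossMap_mem_algebraicClasses_of_hodgeClasses_eq_top_right hHD hX hX hij (heven b hbn) (halgX a)
        (fun z ↦ halgX b z (by rw [heven b hbn]; exact Submodule.mem_top)) ht
    · exact BettiUniverse.ofRatClass_crossMap_mem_algebraicClasses_of_hodgeClasses_eq_top_left hHD hX hX hij (heven a han)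
        (fun z ↦ halgX a z (by rw [heven a han]; exact Submodule.mem_top)) (halgX b) ht
  · by_cases hin : i = n
    · -- then `j` is odd and `≠ n`
      have hjo : Odd j := by
        rcases Nat.even_or_odd j with ⟨b, hb⟩ | hjo
        · exfalso
          obtain ⟨k, hk⟩ := hio
          omega
        · exact hjo
      have hjn : j ≠ n := fun h ↦ hmid ⟨hin, h⟩
      exact BettiUniverse.ofRatClass_crossMap_mem_algebraicClasses_of_finrank_eq_zero hX hX hij (Or.inr (hodd j hjo hjn)) t
    · exact BettiUniverse.ofRatClass_crossMap_mem_algebraicClasses_of_finrank_eq_zero hX hX hij (Or.inl (hodd i hio hin)) t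

end Literature.AlgebraicGeometry.HodgeTheory

end
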